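import Literature.NumberTheory.Automorphic.RestrictedProductFixedVectorLift
import Literature.NumberTheory.Automorphic.IsotypicHeckeScalar
import Literature.RepresentationTheory.IsotypicFamilyRigidity
import Literature.NumberTheory.Automorphic.FlathBaseVector
import Literature.NumberTheory.Automorphic.UnitaryGroupPlaceInclusion
import Literature.NumberTheory.Automorphic.RestrictedTensorProductIrreducibleProofs
import Mathlib.LinearAlgebra.Basis.VectorSpace
import HarnessLib

/-!
# Stub CF `stub_CF_flathRigidity` of line `Cruxes/H413/Lines/F0_P2CohFinComponentIsThetaC.lean` (crux item stmt-HodgeConjecture-24833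
# `HCCMUnconditional.H413`, programme P2, cell hodgecm-mathlib FLOOR 0): FLATH RIGIDITY for `U(J)(𝔸_{F,f})`

`σ`, `ω` irreducible admissible representations of the finite-adelic unitary group `U(J)(𝔸_{F,f}) = finAdelic F E c N J` with a
common irreducible local type at every finite place admit an injective intertwiner `σ → ω` — the uniqueness half of Flath's
tensor product theorem ([Flath1979, Thm. 3]; Bump 1997, Thm. 3.4.4; Borel–Jacquet 1979, §4.3) proved WITHOUT restricted tensor
products and WITHOUT the Gelfand-pair∕Satake hypothesis, for every `J`.

ROAD (lead A-p08 (g16); ★ = in the tree): transport along ★ `finAdelicEquiv : U(J)(𝔸_{F,f}) ≃ₜ* Πʳ_v (U(J)(F_v) : U(J)(𝒪_v))`;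
boxes fixing non-zero vectors (★ `FlathBaseVector.exists_boxSubgroup_fixedPoints_ne_bot`); a finite set `S` of bad places off which
`dim τ_v^{U(J)(𝒪_v)} = 1` (HYPOTHESIS `hsph` of `stubCF_of_local` — the dimension count ★ `prod_finrank_invariants_le` packaged for
`U(J)` by the F0P2 hands) and both boxes are full; the local Hecke operators off `S` act on both sides by the SAME scalars (★
`IsotypicHeckeScalar`); the `K^S`-fixed vectors are irreducible for the `S`-places (★ `RestrictedProductFixedVectorLift.boxFixed_le_of_stable`);
finite-family rigidity (★ `IsotypicFamilyRigidity`) gives an injective `S`-equivariant `ψ : σ^{K^S} → ω^{K^S}`; the lift (★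
`exists_equiv_of_boxFixed_equivariant`) gives `σ ≅ ω`.  Schur for the local types comes from their admissibility (HYPOTHESIS `hadm`
of `stubCF_of_local`; ★ `Representation.IsAdmissible.exists_eq_smul_id`).

This file: `stubCF_of_local` — the registered CF body with the local types CHOSEN and the two local inputs (admissibility of the
types, sphericity off a finite set) as hypotheses, smoothness of `σ`, `ω` in place of admissibility.  The closer
`Theorems/P2StubCFFlathRigidity.lean :: stubCF_holds` (CF body verbatim, `IsLocalTypeAt` unfolded) imports this file and the two
local inputs (F0P2-p04 (g2), `Automorphic/LocalTypeSphericalAlmostAll`: local types of an admissible `ω` are admissible, and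
spherical at almost every place).
HC_CM is proved only modulo the 7 printed citations until rung 0 closes; this file discharges none of them.
-/

set_option autoImplicit false
-- the mandated namespace has the single-problem summit's repeated segment (`HodgeConjecture.HodgeConjecture`)
set_option linter.dupNamespace false

noncomputable section

open NumberField IsDedekindDomain MulAction Filter
open scoped RestrictedProduct MonoidAlgebra

namespace Summit.HodgeConjecture.HodgeConjecture.Cruxes.H413.P2StubCFOfLocal

open Literature.NumberTheory.Automorphic Literature.NumberTheory.Automorphic.UnitaryGroup
open Literature.RepresentationTheory

universe u

/-! ## §1 Generic plumbing -/

section Plumbing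

variable {k : Type*} [Field k] {Γ H : Type*} [Group Γ] [Group H] {V : Type*} [AddCommGroup V] [Module k V]

/-- Irreducibility is insensitive to composing with a group isomorphism. [folklore] -/
theorem isIrreducible_comp_mulEquiv (ρ : Representation k Γ V) [ρ.IsIrreducible] (e : H ≃* Γ) :
    Representation.IsIrreducible (ρ.comp e.toMonoidHom) := by
  let f : Subrepresentation (ρ.comp e.toMonoidHom) ≃o Subrepresentation ρ :=
    { toFun := fun p => ⟨p.toSubmodule, fun g v hv => by simpa using p.apply_mem_toSubmodule (e.symm g) hv⟩
      invFun := fun q => ⟨q.toSubmodule, fun h v hv => q.apply_mem_toSubmodule (e h) hv⟩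
      left_inv := fun p => rfl
      right_inv := fun q => rfl
      map_rel_iff' := Iff.rfl }
  exact f.isSimpleOrder_iff.2 inferInstance

variable {G : Type*} [Group G] {X W : Type u} [AddCommGroup X] [Module k X] [AddCommGroup W] [Module k W]

/-- Isotypy passes to a representation embedding equivariantly into an isotypic one. [folklore] -/
theorem isotypicComponent_eq_top_of_injective {T : Type u} [AddCommGroup T] [Module k T] (τ : Representation k G T)
    [τ.IsIrreducible] (ρX : Representation k G X) (ρW : Representation k G W) (Φ : ρX.IntertwiningMap ρW)
    (hΦ : Function.Injective Φ) (hW : isotypicComponent k[G] ρW.asModule τ.asModule = ⊤) :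
    isotypicComponent k[G] ρX.asModule τ.asModule = ⊤ := by
  haveI : IsSemisimpleModule k[G] (⊤ : Submodule k[G] ρW.asModule) := hW ▸ inferInstance
  haveI : IsSemisimpleModule k[G] ρW.asModule := IsSemisimpleModule.congr Submodule.topEquiv.symm
  let ΦA : ρX.asModule →ₗ[k[G]] ρW.asModule := Representation.IntertwiningMap.equivLinearMapAsModule ρX ρW Φ
  have hΦA : Function.Injective ΦA := fun a b h => hΦ h
  haveI : IsSemisimpleModule k[G] ρX.asModule := IsSemisimpleModule.congr (LinearEquiv.ofInjective ΦA hΦA)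
  exact isotypicComponent_eq_top_iff.2 ((IsIsotypicOfType.of_isotypicComponent_eq_top hW).of_injective ΦA hΦA)

end Plumbing

/-! ## §2 The rigidity theorem with the local inputs as hypotheses -/

set_option maxHeartbeats 1600000 in
/-- **CF with chosen local types and the two local inputs as hypotheses.**  For irreducible `σ` (smooth) and `ω` on
`U(J)(𝔸_{F,f})`, a family of irreducible local types `τ v` common to `σ` and `ω`, each ADMISSIBLE (`hadm`; this is automatic from
`ω` admissible) and SPHERICAL off a finite set (`hsph`: `dim (τ v)^{U(J)(𝒪_v)} = 1` for almost all `v`; automatic from `ω`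
admissible): there is an injective intertwiner `σ → ω`.  (print: Flath1979 Thm 3; Bump 1997 Thm 3.4.4, Prop 4.2.3; BorelJacquet1979 §4.3) -/
theorem stubCF_of_local (F E : Type) [Field F] [NumberField F] [Field E] [NumberField E] [Algebra F E] (c : E ≃ₐ[F] E) (N : ℕ)
    (J : Matrix (Fin N) (Fin N) E) (W W' : Type) [AddCommGroup W] [Module ℂ W] [AddCommGroup W'] [Module ℂ W']
    (σ : Representation ℂ (finAdelic F E c N J) W) (ω : Representation ℂ (finAdelic F E c N J) W')
    (hσirr : σ.IsIrreducible) (hσsm : σ.IsSmooth) (hωirr : ω.IsIrreducible) (hωsm : ω.IsSmooth)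
    {T : HeightOneSpectrum (𝓞 F) → Type} [∀ v, AddCommGroup (T v)] [∀ v, Module ℂ (T v)]
    (τ : ∀ v, Representation ℂ (localPi E c N J v) (T v)) (hτirr : ∀ v, (τ v).IsIrreducible)
    (hτσ : ∀ v, isotypicComponent (MonoidAlgebra ℂ (localPi E c N J v))
      (Representation.asModule (σ.comp (inclPlace F E c N J v))) (Representation.asModule (τ v)) = ⊤)
    (hτω : ∀ v, isotypicComponent (MonoidAlgebra ℂ (localPi E c N J v))
      (Representation.asModule (ω.comp (inclPlace F E c N J v))) (Representation.asModule (τ v)) = ⊤)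
    (hadm : ∀ v, (τ v).IsAdmissible)
    (hsph : ∀ᶠ v in cofinite, Module.finrank ℂ ((τ v).fixedPoints (localInt E c N J v)) = 1) :
    ∃ f : σ.IntertwiningMap ω, Function.Injective f := by
  classical
  haveI := hσirr; haveI := hωirr; haveI : ∀ v, (τ v).IsIrreducible := hτirr
  -- transport along `finAdelicEquiv`
  set e := finAdelicEquiv F E c N J with he
  let σ' : Representation ℂ (Πʳ v : HeightOneSpectrum (𝓞 F), [localPi E c N J v, localInt E c N J v]) W :=
    σ.comp e.symm.toMonoidHom
  let ω' : Representation ℂ (Πʳ v : HeightOneSpectrum (𝓞 F), [localPi E c N J v, localInt E c N J v]) W' :=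
    ω.comp e.symm.toMonoidHom
  haveI : σ'.IsIrreducible := isIrreducible_comp_mulEquiv σ e.symm.toMulEquiv
  haveI : ω'.IsIrreducible := isIrreducible_comp_mulEquiv ω e.symm.toMulEquiv
  have hσ'sm : σ'.IsSmooth := fun w => by
    have : ((σ'.stabilizerSubgroup w : Set _)) = e.symm ⁻¹' (σ.stabilizerSubgroup w : Set (finAdelic F E c N J)) := rfl
    rw [Representation.IsSmoothVector, this]
    exact (hσsm w).preimage e.symm.continuous
  have hω'sm : ω'.IsSmooth := fun w => by
    have : ((ω'.stabilizerSubgroup w : Set _)) = e.symm ⁻¹' (ω.stabilizerSubgroup w : Set (finAdelic F E c N J)) := rfl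
    rw [Representation.IsSmoothVector, this]
    exact (hωsm w).preimage e.symm.continuous
  -- the local restrictions: `σ' ∘ ι_v = σ ∘ inclPlace v`
  have hσ'loc : ∀ v, σ'.comp (mulSingleHom (fun v => localInt E c N J v) v) = σ.comp (inclPlace F E c N J v) := fun v => rfl
  have hω'loc : ∀ v, ω'.comp (mulSingleHom (fun v => localInt E c N J v) v) = ω.comp (inclPlace F E c N J v) := fun v => rfl
  -- topology of the local factors
  have hKo : ∀ v, IsOpen (localInt E c N J v : Set (localPi E c N J v)) := fun v => isOpen_localInt E c N J v
  have hKc : ∀ v, IsCompact (localInt E c N J v : Set (localPi E c N J v)) := fun v => isCompact_localInt E c N J v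
  have hfinK : ∀ v (a : localPi E c N J v), (orbit (localInt E c N J v) (a : localPi E c N J v ⧸ localInt E c N J v)).Finite :=
    fun v a => by
      haveI := isHeckeTriple_top_of_isCompact_isOpen (localInt E c N J v) (hKc v) (hKo v)
      exact finite_orbit_quotient (localInt E c N J v) a
  -- Schur for the local types (admissible irreducible)
  have hSchur : ∀ v (φ : (τ v).IntertwiningMap (τ v)), ∃ c : ℂ, ∀ x, φ x = c • x := fun v φ => by
    obtain ⟨c, hc⟩ := (hadm v).exists_eq_smul_id (hKo v) (hKc v) φ.toLinearMap fun g => φ.isIntertwining' g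
    exact ⟨c, fun x => by simpa using LinearMap.congr_fun hc x⟩
  -- boxes fixing non-zero vectors
  obtain ⟨Lσ, -, -, hLσK, hLσev, hσbox⟩ :=
    exists_boxSubgroup_fixedPoints_ne_bot σ' hKo hKc hσ'sm
  obtain ⟨Lω, -, -, hLωK, hLωev, hωbox⟩ :=
    exists_boxSubgroup_fixedPoints_ne_bot ω' hKo hKc hω'sm
  -- the finite set of bad places
  have hSfin : {v | ¬(Lσ v = localInt E c N J v ∧ Lω v = localInt E c N J v ∧
      Module.finrank ℂ ((τ v).fixedPoints (localInt E c N J v)) = 1)}.Finite := by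
    have := (hLσev.and (hLωev.and hsph))
    rwa [Filter.eventually_cofinite] at this
  set S : Finset (HeightOneSpectrum (𝓞 F)) := hSfin.toFinset with hSdef
  have hgood : ∀ v, v ∉ S → Lσ v = localInt E c N J v ∧ Lω v = localInt E c N J v ∧
      Module.finrank ℂ ((τ v).fixedPoints (localInt E c N J v)) = 1 := fun v hv => by
    by_contra h
    exact hv (hSfin.mem_toFinset.2 h)
  let L : ∀ v, Subgroup (localPi E c N J v) := fun v => if v ∈ S then ⊥ else localInt E c N J v
  have hLS : ∀ v ∈ S, L v = ⊥ := fun v hv => by simp [L, hv]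
  have hLK : ∀ v, v ∉ S → L v = localInt E c N J v := fun v hv => by simp [L, hv]
  set C := boxSubgroup (K := fun v => localInt E c N J v) L with hCdef
  have hfinL : ∀ v, v ∉ S → ∀ a : localPi E c N J v, (orbit (L v) (a : localPi E c N J v ⧸ L v)).Finite := fun v hv a => by
    rw [hLK v hv]; exact hfinK v a
  -- `σ'^C ≠ 0`, `ω'^C ≠ 0`
  have hLle : ∀ (L' : ∀ v, Subgroup (localPi E c N J v)), (∀ v, v ∉ S → L' v = localInt E c N J v) →
      C ≤ boxSubgroup (K := fun v => localInt E c N J v) L' := fun L' hL' γ hγ v => by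
    by_cases hv : v ∈ S
    · have : γ v = 1 := by simpa [hLS v hv] using hγ v
      rw [this]; exact (L' v).one_mem
    · rw [hL' v hv, ← hLK v hv]; exact hγ v
  have hσC : σ'.fixedPoints C ≠ ⊥ := fun h => hσbox (eq_bot_iff.2 (h ▸
    Representation.fixedPoints_antitone σ' (hLle Lσ fun v hv => (hgood v hv).1)))
  have hωC : ω'.fixedPoints C ≠ ⊥ := fun h => hωbox (eq_bot_iff.2 (h ▸
    Representation.fixedPoints_antitone ω' (hLle Lω fun v hv => (hgood v hv).2.1)))
  -- the local scalars off `S` (the same for `σ'` and `ω'`: they are the scalars of `τ v`)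
  have hsc : ∀ v (a : localPi E c N J v), ∃ cva : ℂ, v ∉ S →
      (∀ w ∈ Representation.fixedPoints (σ'.comp (mulSingleHom (fun v => localInt E c N J v) v)) (L v),
        heckeOperator (σ'.comp (mulSingleHom (fun v => localInt E c N J v) v)) (L v) a w = cva • w) ∧
      (∀ w ∈ Representation.fixedPoints (ω'.comp (mulSingleHom (fun v => localInt E c N J v) v)) (L v),
        heckeOperator (ω'.comp (mulSingleHom (fun v => localInt E c N J v) v)) (L v) a w = cva • w) := by
    intro v a
    by_cases hv : v ∈ S
    · exact ⟨0, fun h => absurd hv h⟩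
    · have h1 := (hgood v hv).2.2
      haveI : FiniteDimensional ℂ ((τ v).fixedPoints (localInt E c N J v)) := Module.finite_of_finrank_eq_succ h1
      obtain ⟨cva, hcva⟩ := exists_heckeOperator_apply_eq_smul_of_finrank_le_one (localInt E c N J v) (τ v) a (hfinK v a) h1.le
      refine ⟨cva, fun _ => ⟨fun w hw => ?_, fun w hw => ?_⟩⟩
      · rw [hLK v hv] at hw ⊢
        rw [hσ'loc v] at hw ⊢
        exact heckeOperator_apply_eq_smul_of_isotypic (localInt E c N J v) (τ v) _ (hτσ v) a (hfinK v a) cva hcva w hw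
      · rw [hLK v hv] at hw ⊢
        rw [hω'loc v] at hw ⊢
        exact heckeOperator_apply_eq_smul_of_isotypic (localInt E c N J v) (τ v) _ (hτω v) a (hfinK v a) cva hcva w hw
  choose cs hcs using hsc
  have hcσ : ∀ v, v ∉ S → ∀ (a : localPi E c N J v),
      ∀ w ∈ Representation.fixedPoints (σ'.comp (mulSingleHom (fun v => localInt E c N J v) v)) (L v),
        heckeOperator (σ'.comp (mulSingleHom (fun v => localInt E c N J v) v)) (L v) a w = cs v a • w :=
    fun v hv a => ((hcs v a) hv).1
  have hcω : ∀ v, v ∉ S → ∀ (a : localPi E c N J v),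
      ∀ w ∈ Representation.fixedPoints (ω'.comp (mulSingleHom (fun v => localInt E c N J v) v)) (L v),
        heckeOperator (ω'.comp (mulSingleHom (fun v => localInt E c N J v) v)) (L v) a w = cs v a • w :=
    fun v hv a => ((hcs v a) hv).2
  -- the `S`-family on the `C`-fixed vectors of a representation `π'` of the restricted product
  have family : ∀ {X : Type} [AddCommGroup X] [Module ℂ X]
      (π : Representation ℂ (finAdelic F E c N J) X)
      (π' : Representation ℂ (Πʳ v : HeightOneSpectrum (𝓞 F), [localPi E c N J v, localInt E c N J v]) X) [π'.IsIrreducible],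
      (∀ v, π'.comp (mulSingleHom (fun v => localInt E c N J v) v) = π.comp (inclPlace F E c N J v)) →
      (∀ v, isotypicComponent (MonoidAlgebra ℂ (localPi E c N J v))
        (Representation.asModule (π.comp (inclPlace F E c N J v))) (Representation.asModule (τ v)) = ⊤) →
      (∀ v, v ∉ S → ∀ (a : localPi E c N J v),
        ∀ w ∈ Representation.fixedPoints (π'.comp (mulSingleHom (fun v => localInt E c N J v) v)) (L v),
          heckeOperator (π'.comp (mulSingleHom (fun v => localInt E c N J v) v)) (L v) a w = cs v a • w) →
      π'.fixedPoints C ≠ ⊥ →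
      ∃ ρX : ∀ v, Representation ℂ (localPi E c N J v) ↥(π'.fixedPoints C),
        (∀ v ∈ S, ∀ (a : localPi E c N J v) (x : ↥(π'.fixedPoints C)),
          ((ρX v a x : ↥(π'.fixedPoints C)) : X) = π' (RestrictedProduct.mulSingle (fun v => localInt E c N J v) v a) x) ∧
        (∀ v v', v ≠ v' → ∀ (a : localPi E c N J v) (a' : localPi E c N J v') (x : ↥(π'.fixedPoints C)),
          ρX v a (ρX v' a' x) = ρX v' a' (ρX v a x)) ∧
        (∀ v ∈ S, isotypicComponent (MonoidAlgebra ℂ (localPi E c N J v)) (ρX v).asModule (τ v).asModule = ⊤) ∧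
        Nontrivial ↥(π'.fixedPoints C) ∧
        (∀ Z : Submodule ℂ ↥(π'.fixedPoints C),
          (∀ v ∈ S, ∀ (a : localPi E c N J v), ∀ z ∈ Z, ρX v a z ∈ Z) → Z = ⊥ ∨ Z = ⊤) := by
    intro X _ _ π π' _ hππ' hiso hc hne
    -- the restricted actions
    have hstab : ∀ v ∈ S, ∀ (a : localPi E c N J v), ∀ x ∈ π'.fixedPoints C,
        π' (RestrictedProduct.mulSingle (fun v => localInt E c N J v) v a) x ∈ π'.fixedPoints C :=
      fun v hv a x hx => apply_mem_fixedPoints_boxSubgroup_of_support L S hLS π'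
        (fun v' hv' => RestrictedProduct.mulSingle_eq_of_ne' (fun v => localInt E c N J v) a (ne_of_mem_of_not_mem hv hv')) hx
    let ρX : ∀ v, Representation ℂ (localPi E c N J v) ↥(π'.fixedPoints C) := fun v =>
      if hv : v ∈ S then
        { toFun := fun a => (π' (RestrictedProduct.mulSingle (fun v => localInt E c N J v) v a)).restrict (hstab v hv a)
          map_one' := by
            apply LinearMap.ext; intro x; apply Subtype.ext
            simp [LinearMap.restrict_apply]
          map_mul' := fun a b => by
            apply LinearMap.ext; intro x; apply Subtype.ext
            simp [LinearMap.restrict_apply, RestrictedProduct.mulSingle_mul] }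
      else 1
    have hρX : ∀ v ∈ S, ∀ (a : localPi E c N J v) (x : ↥(π'.fixedPoints C)),
        ((ρX v a x : ↥(π'.fixedPoints C)) : X) = π' (RestrictedProduct.mulSingle (fun v => localInt E c N J v) v a) x :=
      fun v hv a x => by simp [ρX, hv, LinearMap.restrict_apply]
    have hρX' : ∀ v, v ∉ S → ∀ (a : localPi E c N J v) (x : ↥(π'.fixedPoints C)), ρX v a x = x :=
      fun v hv a x => by simp [ρX, hv]
    refine ⟨ρX, hρX, ?_, ?_, Submodule.nontrivial_iff_ne_bot.2 hne, ?_⟩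
    · -- commutation
      intro v v' hvv' a a' x
      by_cases hv : v ∈ S
      · by_cases hv' : v' ∈ S
        · apply Subtype.ext
          rw [hρX v hv, hρX v' hv', hρX v' hv', hρX v hv, ← Module.End.mul_apply, ← map_mul,
            (mulSingle_commute_of_ne (K := fun v => localInt E c N J v) hvv' a a').eq, map_mul, Module.End.mul_apply]
        · rw [hρX' v' hv', hρX' v' hv']
      · rw [hρX' v hv, hρX' v hv]
    · -- isotypy on `S`: the inclusion is an injective `G_v`-map into `π ∘ inclPlace v`
      intro v hv
      let Φ : (ρX v).IntertwiningMap (π.comp (inclPlace F E c N J v)) :=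
        LinearMap.intertwiningMap_of_isIntertwiningMap (ρX v) (π.comp (inclPlace F E c N J v)) (π'.fixedPoints C).subtype
          fun a x => by rw [Submodule.subtype_apply, hρX v hv, ← hππ' v]; rfl
      exact isotypicComponent_eq_top_of_injective (τ v) (ρX v) _ Φ (fun x y h => Subtype.ext h) (hiso v)
    · -- irreducibility for the `S`-places: (R1)
      intro Z hZ
      by_cases hZ0 : Z = ⊥
      · exact Or.inl hZ0
      right
      let Zw : Submodule ℂ X := Z.map (π'.fixedPoints C).subtype
      have hZwC : Zw ≤ π'.fixedPoints C := by
        rintro _ ⟨z, -, rfl⟩; exact z.2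
      have hZw0 : Zw ≠ ⊥ := by
        intro h
        apply hZ0
        rw [eq_bot_iff]
        intro z hz
        have : ((π'.fixedPoints C).subtype z) ∈ Zw := ⟨z, hz, rfl⟩
        rw [h, Submodule.mem_bot] at this
        rw [Submodule.mem_bot]
        exact Subtype.ext this
      have hZwst : ∀ v ∈ S, ∀ (a : localPi E c N J v), ∀ z ∈ Zw,
          π' (RestrictedProduct.mulSingle (fun v => localInt E c N J v) v a) z ∈ Zw := by
        rintro v hv a _ ⟨z, hz, rfl⟩
        exact ⟨ρX v a z, hZ v hv a z hz, (hρX v hv a z).trans rfl⟩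
      have hle := boxFixed_le_of_stable L S cs hLS hLK hfinL π' hc Zw hZwC hZw0 hZwst
      rw [eq_top_iff]
      intro x _
      obtain ⟨z, hz, hzx⟩ := hle x.2
      have : z = x := Subtype.ext hzx
      exact this ▸ hz
  obtain ⟨ρ₁, hρ₁, hcomm₁, hiso₁, hX₁, hirr₁⟩ := family σ σ' hσ'loc hτσ hcσ hσC
  obtain ⟨ρ₂, hρ₂, hcomm₂, hiso₂, hX₂, hirr₂⟩ := family ω ω' hω'loc hτω hcω hωC
  -- finite-family rigidity: an injective `S`-equivariant `ψ : σ'^C → ω'^C`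
  obtain ⟨ψ, hψinj, hψ⟩ := exists_injective_equivariant_of_isotypic_family S τ (fun v _ => hSchur v)
    ↥(σ'.fixedPoints C) ↥(ω'.fixedPoints C) ρ₁ ρ₂ hcomm₁ hcomm₂ hiso₁ hiso₂ hX₁ hirr₁ hX₂ hirr₂
  -- extend `ψ` to `W` and lift to an isomorphism `σ' ≅ ω'`
  obtain ⟨φ, hφ⟩ := LinearMap.exists_extend ((ω'.fixedPoints C).subtype ∘ₗ ψ)
  have hφψ : ∀ v (hv : v ∈ σ'.fixedPoints C), φ v = (ψ ⟨v, hv⟩ : W') := fun v hv => by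
    simpa using LinearMap.congr_fun hφ ⟨v, hv⟩
  obtain ⟨Eq, -⟩ := exists_equiv_of_boxFixed_equivariant L S cs hLS hLK hfinL σ' ω' hcσ hcω φ
    (fun v hv => by rw [hφψ v hv]; exact (ψ ⟨v, hv⟩).2)
    (fun v hv a x hx => by
      have hx' := apply_mem_fixedPoints_boxSubgroup_of_support L S hLS σ'
        (fun v' hv' => RestrictedProduct.mulSingle_eq_of_ne' (fun v => localInt E c N J v) a (ne_of_mem_of_not_mem hv hv')) hx
      have h1 : (⟨σ' (RestrictedProduct.mulSingle (fun v => localInt E c N J v) v a) x, hx'⟩ : ↥(σ'.fixedPoints C)) =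
          ρ₁ v a ⟨x, hx⟩ := Subtype.ext (by rw [hρ₁ v hv a])
      rw [hφψ _ hx', hφψ x hx, h1, hψ v hv a ⟨x, hx⟩, hρ₂ v hv a])
    (by
      obtain ⟨x, hx⟩ := exists_ne (0 : ↥(σ'.fixedPoints C))
      refine ⟨x, x.2, fun h => hx (hψinj ?_)⟩
      rw [map_zero]
      apply Subtype.ext
      rw [← hφψ x x.2]
      simpa using h)
  -- back to `U(J)(𝔸_{F,f})`
  refine ⟨LinearMap.intertwiningMap_of_isIntertwiningMap σ ω Eq.toLinearMap fun g w => ?_, Eq.toLinearEquiv.injective⟩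
  have h := Representation.IntertwiningMap.isIntertwining _ _ Eq.toIntertwiningMap (e g) w
  change Eq (σ (e.symm (e g)) w) = ω (e.symm (e g)) (Eq w) at h
  rw [ContinuousMulEquiv.symm_apply_apply] at h
  exact h

end Summit.HodgeConjecture.HodgeConjecture.Cruxes.H413.P2StubCFOfLocal

end
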